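import Summits.AtomisticToContinuum.FouriersLaw.Theorems.PhononMeanFreePathIncoherentChannelTimeResolvedBudget
import Summits.AtomisticToContinuum.FouriersLaw.Theorems.PhononMeanFreePathIncoherentChannelLightConeReduction
import Summits.AtomisticToContinuum.FouriersLaw.Theorems.JunctionLocalityConductanceLowerBoundStubFarMomentumPoincare
import Mathlib.Probability.Distributions.Gaussian.Real

/-!
# `IncoherentChannel`, line `two-horizons-forecast-loss` — the left-sensitivity budget of the bath momentum

Helper file for the registered stub `leftSensitivity_budget_of_smooth` of crux
`PhononMeanFreePath.IncoherentChannel` (item stmt-AtomisticToContinuum-11811, route `PhononMeanFreePath`,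
sub-problem `FouriersLaw`), in the vocabulary of `PhononMeanFreePathDefs`.

`P = pinnedChain ω₂ lam β γ` is the `(N+1)`-site pinned anharmonic chain with both Langevin baths at `T > 0`,
`μ₀ = P.gibbsMeasure (N+1) T`, `K_s = P.transitionKernel (N+1) T T s⁺`, `ν = gaussianReal 0 T`, and for
`x = (z, σ)` the RESAMPLED microstate is `z̃ = (z.1, update z.2 0 σ)` (the near-bath momentum `p₀` replaced by a
fresh Gaussian). The mean forecast of the far bath momentum is `v_s = fcast … N s = K_s p_N`.

The SMOOTH left-sensitivity budget (the antecedent; proved elsewhere on the line) says that for every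
`F ∈ C_c` and every `t > 0`

  `∫_{0<s≤t} ∫ ((K_s F)(z) - (K_s F)(z̃))² d(μ₀ ⊗ ν) ds ≤ (π²/(8γ)) ∫ F² dμ₀`.

This file transfers it to the (non compactly supported) bath momentum `F = p_N`, `∫ p_N² dμ₀ = T`:

  `∫_{0<s≤t} ∫ (v_s(z) - v_s(z̃))² d(μ₀ ⊗ ν) ds ≤ π² T/(8γ)`     (`leftSensitivity_budget_of_smooth`),

by the truncation argument of `forecastBudget_timeResolved_lintegral_le` (file `…TimeResolvedBudget`):
`F_k = χ_k p_N ∈ C_c` with `|F_k| ≤ |p_N|`, `F_k → p_N`, `∫ F_k² dμ₀ ≤ T`; dominated convergence inside the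
kernels gives `K_s F_k → v_s` pointwise; `ofReal (∫ g) ≤ ∫⁻ ofReal g` (the tree's
`FarContactFisherSquare.ofReal_integral_le_lintegral_ofReal`) and Fatou in `x = (z, σ)` (the approximating
integrands are jointly measurable in `(s, z)` by the joint measurability of the transition kernels), Fatou in `s`,
and the smooth budget of each truncation. No definitions; nothing here closes an item.
-/

noncomputable section

namespace Summit.AtomisticToContinuum.FouriersLaw.Theorems.PhononMeanFreePath

open MeasureTheory Set Filter Topology ProbabilityTheory
open scoped NNReal ENNReal
open Literature.MathematicalPhysics.KineticTheory.HeatConduction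
open Summit.AtomisticToContinuum.FouriersLaw.Theorems.IncoherentBounded
open Summit.AtomisticToContinuum.FouriersLaw.Theorems.SubdiffusiveBondHeat
open Summit.AtomisticToContinuum.FouriersLaw.Cruxes.ConductanceLowerBound.FarContactFisherSquare
  (ofReal_integral_le_lintegral_ofReal)

section Core

variable {ω₂ lam β γ : ℝ} (hω : 0 < ω₂) (hl : 0 ≤ lam) (hβ : 0 < β) (hγ : 0 < γ) {T : ℝ} (hT : 0 < T)
include hω hl hβ hγ hT

/-- **The left-sensitivity budget of the bath momentum from the smooth budget** (core, curried form).
If for every `F ∈ C_c(Ω_{N+1})` and every `t > 0`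
`∫_{0<s≤t} ∫⁻ ofReal(((K_sF)(z) - (K_sF)(z̃))²) d(μ₀ ⊗ ν) ≤ ofReal((π²/(8γ)) ∫ F² dμ₀)`, then for every `N` and
`t > 0`, with `v_s = fcast … N s = K_s p_N`,
`∫_{0<s≤t} ofReal(∫ (v_s(z) - v_s(z̃))² d(μ₀ ⊗ ν)) ≤ ofReal(π² T/(8γ))`:
truncate `p_N` to `F_k = χ_k p_N ∈ C_c` (`∫ F_k² dμ₀ ≤ T`), pass to the limit inside the forecasts by dominated
convergence, then Fatou in `x` and Fatou in `s`.
(adapted from `forecastBudget_timeResolved_lintegral_le`) [folklore] -/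
theorem leftSensitivity_budget_of_smooth_core
    (hS : ∀ (N : ℕ) (F : PhaseSpace (N + 1) → ℝ), Continuous F → HasCompactSupport F → ∀ t : ℝ, 0 < t →
      ∫⁻ s in Ioc (0 : ℝ) t, (∫⁻ x : PhaseSpace (N + 1) × ℝ, ENNReal.ofReal
        (((∫ y, F y ∂((pinnedChain ω₂ lam β γ).transitionKernel (N + 1) T T s.toNNReal x.1)) -
          (∫ y, F y ∂((pinnedChain ω₂ lam β γ).transitionKernel (N + 1) T T s.toNNReal
            ((x.1.1, Function.update x.1.2 0 x.2) : PhaseSpace (N + 1))))) ^ 2)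
        ∂(((pinnedChain ω₂ lam β γ).gibbsMeasure (N + 1) T).prod (gaussianReal 0 T.toNNReal))) ≤
      ENNReal.ofReal (Real.pi ^ 2 / (8 * γ) * ∫ x, F x ^ 2 ∂((pinnedChain ω₂ lam β γ).gibbsMeasure (N + 1) T)))
    (N : ℕ) {t : ℝ} (ht : 0 < t) :
    ∫⁻ s in Ioc (0 : ℝ) t, ENNReal.ofReal (∫ x : PhaseSpace (N + 1) × ℝ,
      (fcast ω₂ lam β γ T N s x.1 -
        fcast ω₂ lam β γ T N s ((x.1.1, Function.update x.1.2 0 x.2) : PhaseSpace (N + 1))) ^ 2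
        ∂(((pinnedChain ω₂ lam β γ).gibbsMeasure (N + 1) T).prod (gaussianReal 0 T.toNNReal))) ≤
      ENNReal.ofReal (Real.pi ^ 2 * T / (8 * γ)) := by
  -- adapted from `forecastBudget_timeResolved_lintegral_le` (file `…IncoherentChannelTimeResolvedBudget`)
  set P := pinnedChain ω₂ lam β γ
  set μ := P.gibbsMeasure (N + 1) T
  set ν : Measure ℝ := gaussianReal 0 T.toNNReal
  haveI : IsProbabilityMeasure μ := pinnedChain_isProbabilityMeasure_gibbsMeasure hω hl hβ.le γ (N + 1) hT
  haveI : ∀ t, IsMarkovKernel (P.transitionKernel (N + 1) T T t) := fun t =>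
    pinnedChain_isMarkovKernel_transitionKernel hω hl hβ.le hγ.le (N + 1) T T t
  have hNp : 0 < N + 1 := Nat.succ_pos N
  -- the truncations `F_k = χ_k · p_N`
  set pL : PhaseSpace (N + 1) → ℝ := fun y => y.2 (Fin.last N)
  have hpLc : Continuous pL := by fun_prop
  set χ : ℕ → ContDiffBump (0 : PhaseSpace (N + 1)) := fun k =>
    ⟨(k : ℝ) + 1, (k : ℝ) + 2, by positivity, by linarith⟩
  set Fk : ℕ → PhaseSpace (N + 1) → ℝ := fun k y => (χ k) y * pL y with hFk
  have hFkc : ∀ k, Continuous (Fk k) := fun k => (χ k).continuous.mul hpLc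
  have hFks : ∀ k, HasCompactSupport (Fk k) := fun k => (χ k).hasCompactSupport.mul_right
  have hFk_le : ∀ k y, |Fk k y| ≤ |pL y| := fun k y => by
    rw [hFk]; dsimp only; rw [abs_mul, abs_of_nonneg (χ k).nonneg]
    exact mul_le_of_le_one_left (abs_nonneg _) (χ k).le_one
  have hFk_lim : ∀ y, Tendsto (fun k => Fk k y) atTop (𝓝 (pL y)) := by
    intro y
    refine tendsto_const_nhds.congr' ?_
    obtain ⟨k₀, hk₀⟩ := exists_nat_ge ‖y‖
    filter_upwards [eventually_ge_atTop k₀] with k hk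
    rw [hFk]; dsimp only
    rw [(χ k).one_of_mem_closedBall, one_mul]
    rw [Metric.mem_closedBall, dist_zero_right]
    calc ‖y‖ ≤ k₀ := hk₀
      _ ≤ k := by exact_mod_cast hk
      _ ≤ (k : ℝ) + 1 := by linarith
  -- `L²(μ₀)`-norms of the truncations: `∫ F_k² dμ₀ ≤ ∫ p_N² dμ₀ = T`
  have hϑ0 : (0 : ℝ) < 1 / (4 * T) := by positivity
  have hϑ1 : 1 / (4 * T) < 1 / T := by
    rw [div_lt_div_iff₀ (by positivity) hT]; nlinarith
  have hexpμ := pinnedChain_integrable_exp_mul_hamiltonian_gibbsMeasure hω hl hβ.le γ (N + 1) hT hϑ1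
  have hpL2 : Integrable (fun y => pL y ^ 2) μ :=
    integrable_of_abs_le_exp hexpμ (by fun_prop) (fun y => by
      rw [abs_of_nonneg (sq_nonneg _)]
      exact sq_momentum_le_exp (γ := γ) hω hl hβ.le hϑ0 y (Fin.last N))
  have hFk2 : ∀ k, ∫ y, Fk k y ^ 2 ∂μ ≤ T := by
    intro k
    rw [← integral_momentum_sq_gibbsMeasure (γ := γ) hω hl hβ hT (N + 1) (Fin.last N)]
    refine integral_mono_of_nonneg (ae_of_all _ fun y => sq_nonneg _) hpL2 (ae_of_all _ fun y => ?_)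
    show Fk k y ^ 2 ≤ y.2 (Fin.last N) ^ 2
    exact (sq_le_sq' (abs_le.1 (hFk_le k y)).1 (abs_le.1 (hFk_le k y)).2).trans (le_of_eq (sq_abs _))
  -- the approximating forecasts `U_k s = K_s F_k` and their pointwise limit `v_s = K_s p_N`
  -- (as ONE function of `(s, z)`, for the joint measurability below)
  set Uk : ℕ → ℝ × PhaseSpace (N + 1) → ℝ := fun k q =>
    ∫ y, Fk k y ∂(P.transitionKernel (N + 1) T T q.1.toNNReal q.2)
  -- dominated convergence inside the kernels
  have hin : ∀ (s : ℝ) (z : PhaseSpace (N + 1)),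
      Tendsto (fun k => Uk k (s, z)) atTop (𝓝 (fcast ω₂ lam β γ T N s z)) := by
    intro s z
    show Tendsto (fun k => ∫ y, Fk k y ∂(P.transitionKernel (N + 1) T T s.toNNReal z)) atTop
      (𝓝 (∫ y, pL y ∂(P.transitionKernel (N + 1) T T s.toNNReal z)))
    have hexpK := pinnedChain_integrable_exp_mul_hamiltonian_transitionKernel hω hl hT hβ.le hγ.le hNp hϑ0 hϑ1
      s.toNNReal z
    have hbd : Integrable (fun y => |pL y|) (P.transitionKernel (N + 1) T T s.toNNReal z) :=
      integrable_of_abs_le_exp hexpK (by fun_prop) (fun y => by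
        rw [abs_abs]; exact abs_momentum_le_exp hω hl hβ.le hϑ0 y (Fin.last N))
    refine tendsto_integral_of_dominated_convergence (fun y => |pL y|)
      (fun k => (hFkc k).aestronglyMeasurable) hbd (fun k => ae_of_all _ fun y => ?_)
      (ae_of_all _ fun y => hFk_lim y)
    rw [Real.norm_eq_abs]; exact hFk_le k y
  -- the resampling map `x = (z, σ) ↦ z̃`
  set R : PhaseSpace (N + 1) × ℝ → PhaseSpace (N + 1) := fun x =>
    ((x.1.1, Function.update x.1.2 0 x.2) : PhaseSpace (N + 1))
  have hRm : Measurable R := lightCone_measurable_resample 0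
  -- joint measurability of `(s, z) ↦ U_k s z` (joint measurability of the transition kernels)
  let κ₂ : Kernel (ℝ≥0 × PhaseSpace (N + 1)) (PhaseSpace (N + 1)) :=
    { toFun := fun p => P.transitionKernel (N + 1) T T p.1 p.2
      measurable' := pinnedChain_measurable_transitionKernel hω hl hβ.le hγ.le (N + 1) T T }
  have hUk_jm : ∀ k, Measurable (Uk k) := by
    intro k
    have hG : StronglyMeasurable fun p : ℝ≥0 × PhaseSpace (N + 1) => ∫ y, Fk k y ∂(κ₂ p) :=
      (hFkc k).stronglyMeasurable.integral_kernel (κ := κ₂)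
    have hG2 : StronglyMeasurable fun q : ℝ × PhaseSpace (N + 1) => ∫ y, Fk k y ∂(κ₂ (q.1.toNNReal, q.2)) :=
      hG.comp_measurable ((measurable_real_toNNReal.comp measurable_fst).prodMk measurable_snd)
    exact hG2.measurable
  -- the approximating integrands, jointly measurable in `(s, x)`
  have hq1 : Measurable fun q : ℝ × (PhaseSpace (N + 1) × ℝ) => ((q.1, q.2.1) : ℝ × PhaseSpace (N + 1)) :=
    measurable_fst.prodMk (measurable_fst.comp measurable_snd)
  have hq2 : Measurable fun q : ℝ × (PhaseSpace (N + 1) × ℝ) => ((q.1, R q.2) : ℝ × PhaseSpace (N + 1)) :=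
    measurable_fst.prodMk (hRm.comp measurable_snd)
  set Gk : ℕ → ℝ × (PhaseSpace (N + 1) × ℝ) → ℝ≥0∞ := fun k q =>
    ENNReal.ofReal ((Uk k (q.1, q.2.1) - Uk k (q.1, R q.2)) ^ 2)
  have hGk_meas : ∀ k, Measurable (Gk k) := fun k =>
    ((((hUk_jm k).comp hq1).sub ((hUk_jm k).comp hq2)).pow_const 2).ennreal_ofReal
  -- (i) for each `s`: Bochner ≤ lower integral, then Fatou in `x`
  have hFx : ∀ s : ℝ, ENNReal.ofReal (∫ x, (fcast ω₂ lam β γ T N s x.1 - fcast ω₂ lam β γ T N s (R x)) ^ 2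
      ∂(μ.prod ν)) ≤ liminf (fun k => ∫⁻ x, Gk k (s, x) ∂(μ.prod ν)) atTop := by
    intro s
    have hl1 : ∀ x, liminf (fun k => Gk k (s, x)) atTop =
        ENNReal.ofReal ((fcast ω₂ lam β γ T N s x.1 - fcast ω₂ lam β γ T N s (R x)) ^ 2) := fun x =>
      (ENNReal.tendsto_ofReal (((hin s x.1).sub (hin s (R x))).pow 2)).liminf_eq
    calc ENNReal.ofReal (∫ x, (fcast ω₂ lam β γ T N s x.1 - fcast ω₂ lam β γ T N s (R x)) ^ 2 ∂(μ.prod ν))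
        ≤ ∫⁻ x, ENNReal.ofReal ((fcast ω₂ lam β γ T N s x.1 - fcast ω₂ lam β γ T N s (R x)) ^ 2) ∂(μ.prod ν) :=
          ofReal_integral_le_lintegral_ofReal (μ.prod ν) fun x => sq_nonneg _
      _ = ∫⁻ x, liminf (fun k => Gk k (s, x)) atTop ∂(μ.prod ν) := lintegral_congr fun x => (hl1 x).symm
      _ ≤ liminf (fun k => ∫⁻ x, Gk k (s, x) ∂(μ.prod ν)) atTop :=
          lintegral_liminf_le fun k => (hGk_meas k).comp measurable_prodMk_left
  -- (ii) measurability in `s` of the approximating terms (Tonelli), for Fatou in `s`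
  have hIk_meas : ∀ k, Measurable fun s : ℝ => ∫⁻ x, Gk k (s, x) ∂(μ.prod ν) := fun k =>
    (hGk_meas k).lintegral_prod_right'
  -- (iii) the smooth budget of each truncation
  have hk_bound : ∀ k, ∫⁻ s in Ioc (0 : ℝ) t, ∫⁻ x, Gk k (s, x) ∂(μ.prod ν) ≤
      ENNReal.ofReal (Real.pi ^ 2 * T / (8 * γ)) := by
    intro k
    refine (hS N (Fk k) (hFkc k) (hFks k) t ht).trans (ENNReal.ofReal_le_ofReal ?_)
    calc Real.pi ^ 2 / (8 * γ) * ∫ x, Fk k x ^ 2 ∂μ ≤ Real.pi ^ 2 / (8 * γ) * T :=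
          mul_le_mul_of_nonneg_left (hFk2 k) (by positivity)
      _ = Real.pi ^ 2 * T / (8 * γ) := by ring
  -- (iv) Fatou in `s` and the conclusion
  calc ∫⁻ s in Ioc (0 : ℝ) t, ENNReal.ofReal (∫ x, (fcast ω₂ lam β γ T N s x.1 -
        fcast ω₂ lam β γ T N s (R x)) ^ 2 ∂(μ.prod ν))
      ≤ ∫⁻ s in Ioc (0 : ℝ) t, liminf (fun k => ∫⁻ x, Gk k (s, x) ∂(μ.prod ν)) atTop :=
        lintegral_mono fun s => hFx s
    _ ≤ liminf (fun k => ∫⁻ s in Ioc (0 : ℝ) t, ∫⁻ x, Gk k (s, x) ∂(μ.prod ν)) atTop :=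
        lintegral_liminf_le hIk_meas
    _ ≤ ENNReal.ofReal (Real.pi ^ 2 * T / (8 * γ)) :=
        liminf_le_of_frequently_le' (Frequently.of_forall hk_bound)

end Core

/-- **THE LEFT-SENSITIVITY BUDGET OF THE BATH MOMENTUM FROM THE SMOOTH BUDGET** (registered stub
`leftSensitivity_budget_of_smooth` of line `two-horizons-forecast-loss`). For the pinned anharmonic chain
(`ω₂, β, γ > 0`, `lam ≥ 0`) with both baths at `T > 0`, `μ₀ = gibbsMeasure (N+1) T`, `K_s` the transition
kernels, `ν = 𝒩(0, T)` and `z̃ = (z.1, update z.2 0 σ)` the microstate with the near-bath momentum resampled: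
IF for every `F ∈ C_c` and `t > 0`
`∫_{0<s≤t} ∫ ((K_sF)(z) - (K_sF)(z̃))² d(μ₀ ⊗ ν) ds ≤ (π²/(8γ)) ∫ F² dμ₀` (lower integrals), THEN for the mean
forecast `v_s = fcast … N s = K_s p_N` of the far bath momentum, every `N` and every `t > 0`,
`∫_{0<s≤t} ∫ (v_s(z) - v_s(z̃))² d(μ₀ ⊗ ν) ds ≤ π² T/(8γ)` — truncation `χ_k p_N → p_N` (`∫ (χ_k p_N)² dμ₀ ≤
∫ p_N² dμ₀ = T`), dominated convergence inside the kernels, Fatou in `(z, σ)` and in `s`. [folklore] -/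
theorem leftSensitivity_budget_of_smooth : (∀ ω₂ lam β γ : ℝ, 0 < ω₂ → 0 ≤ lam → 0 < β → 0 < γ → ∀ T : ℝ, 0 < T → ∀ (N : ℕ) (F : PhaseSpace (N + 1) → ℝ), Continuous F → HasCompactSupport F → ∀ t : ℝ, 0 < t → ∫⁻ s in Ioc (0 : ℝ) t, (∫⁻ x : PhaseSpace (N + 1) × ℝ, ENNReal.ofReal (((∫ y, F y ∂((pinnedChain ω₂ lam β γ).transitionKernel (N + 1) T T s.toNNReal x.1)) - (∫ y, F y ∂((pinnedChain ω₂ lam β γ).transitionKernel (N + 1) T T s.toNNReal ((x.1.1, Function.update x.1.2 0 x.2) : PhaseSpace (N + 1))))) ^ 2) ∂(((pinnedChain ω₂ lam β γ).gibbsMeasure (N + 1) T).prod (ProbabilityTheory.gaussianReal 0 T.toNNReal))) ≤ ENNReal.ofReal (Real.pi ^ 2 / (8 * γ) * ∫ x, F x ^ 2 ∂((pinnedChain ω₂ lam β γ).gibbsMeasure (N + 1) T))) → ∀ ω₂ lam β γ : ℝ, 0 < ω₂ → 0 ≤ lam → 0 < β → 0 < γ → ∀ T : ℝ, 0 < T →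 ∀ (N : ℕ) (t : ℝ), 0 < t → ∫⁻ s in Ioc (0 : ℝ) t, ENNReal.ofReal (∫ x : PhaseSpace (N + 1) × ℝ, (fcast ω₂ lam β γ T N s x.1 - fcast ω₂ lam β γ T N s ((x.1.1, Function.update x.1.2 0 x.2) : PhaseSpace (N + 1))) ^ 2 ∂(((pinnedChain ω₂ lam β γ).gibbsMeasure (N + 1) T).prod (ProbabilityTheory.gaussianReal 0 T.toNNReal))) ≤ ENNReal.ofReal (Real.pi ^ 2 * T / (8 * γ)) :=
  fun hS ω₂ lam β γ hω hl hβ hγ T hT N _ ht =>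
    leftSensitivity_budget_of_smooth_core hω hl hβ hγ hT (hS ω₂ lam β γ hω hl hβ hγ T hT) N ht

end Summit.AtomisticToContinuum.FouriersLaw.Theorems.PhononMeanFreePath

end
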